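import Summits.CriticalPhenomena.PercolationContinuityZ3.Theorems.PercNearOneGluingNoHeavyLowerTailFKHullPortPv
import HarnessLib

/-!
# FK sub-lane: `T_A^{FK} ≥ 0` and Lemma `Δ_N^{FK}` for every monotone test function (layer cake)

Support file (`--supports stmt-CriticalPhenomena-4575`), FK sub-lane `prim-bschramm-fk-2` (gen 3); builds on p205010 (kernel theorem,
internal audit signed; external expert review pending).  No definitions, no named facts, no sorries; standard axioms.

`FK.taB_singleton_le` proves Lemma `P_v` for `φ_{𝐩,q}` for indicator test functions `1_U`; both sides of `P_v` are linear in the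
test function and vanish on constants (`FK.taB_add_smul`, `FK.taB_const`, `FK.wE_add_smul`, `FK.wE_const`), so peeling the least
positive value of `g − g(∅)` (prove-5's layer cake, `HullPort.taQ_nonneg_of_PvI`) gives `P_v` for every monotone `g`
(`FK.taB_singleton_le_of_monotone`) and hence the fully unconditional
* `FK.taQ_nonneg` — `T_A ≥ 0` for `φ_{w,q}`, `q ≥ 1`, every avoided set `X` (weight-one pairs inside `X`), every root, every
  monotone test function (prim-hp-7's (F1) for the random-cluster measure), and
* `FK.deltaN_nonneg` — the located FK lemma `(Δ)` = Lemma `Δ_N^{FK}` (bschramm/FK-Q2.md §12) for every monotone test function.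
[cite: Grimmett2006, Thm. (3.8)(b) (p. 39), (2.17)] [cite: VandenbergHaggstromKahn2005, Thm. 1.3 (p. 6)] [cite: Gladkov2024, Thm. 3.2 (p. 4)]
-/

noncomputable section

namespace Summit.CriticalPhenomena.PercolationContinuityZ3.Theorems.FK

open MeasureTheory Set
open Literature.Probability.LatticeModels Literature.Probability.Percolation
open Literature.Probability.Percolation.DecisionTree (ind ind_of_mem ind_of_not_mem ind_nonneg)
open Literature.Probability.Percolation.BHK2006 (rcMass rcMass_nonneg sum_rcMass delW)
open Summit.CriticalPhenomena.PercolationContinuityZ3.Theorems.HullPort (cut avoidEv)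
open scoped Classical

variable {V : Type*} [Fintype V]

/-! ### Linearity of the hull-port functionals in the test function -/

/-- `wE` is linear in the integrand. [folklore] -/
theorem wE_add_smul (w : Sym2 V → unitInterval) (q : ℝ) (B : Set (Sym2 V)) (c : ℝ) (φ ψ : Set (Sym2 V) → ℝ) :
    wE w q B (fun η => c * φ η + ψ η) = c * wE w q B φ + wE w q B ψ := by
  simp only [wE, Finset.mul_sum, ← Finset.sum_add_distrib]
  refine Finset.sum_congr rfl fun η _ => ?_
  ring

/-- `wE` of a constant multiple. [folklore] -/
theorem wE_const_mul (w : Sym2 V → unitInterval) (q : ℝ) (B : Set (Sym2 V)) (c : ℝ) (φ : Set (Sym2 V) → ℝ) :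
    wE w q B (fun η => c * φ η) = c * wE w q B φ := by
  simp only [wE, Finset.mul_sum]
  refine Finset.sum_congr rfl fun η _ => ?_
  ring

/-- `wE` of a constant is the constant (the world measures are probability measures, `q > 0`).
[cite: Grimmett2006, §1.4 eq. (1.20) (p. 15)] -/
theorem wE_const (w : Sym2 V → unitInterval) {q : ℝ} (hq : 0 < q) (B : Set (Sym2 V)) (c : ℝ) :
    wE w q B (fun _ => c) = c := by
  simp only [wE]
  rw [← Finset.sum_mul, sum_rcMass _ hq, one_mul]

/-- `taC` is linear in the test function. [folklore] -/
theorem taC_add_smul (w : Sym2 V → unitInterval) (q : ℝ) (s y : V) (X : Set V) (c : ℝ) (g₁ g₂ : Set (Sym2 V) → ℝ)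
    (ω : Set (Sym2 V)) :
    taC w q s y X (fun C => c * g₁ C + g₂ C) ω = c * taC w q s y X g₁ ω + taC w q s y X g₂ ω := by
  simp only [taC]
  have h1 : (fun η : Set (Sym2 V) => (c * g₁ (openEdgeCluster η s) + g₂ (openEdgeCluster η s)) *
      ind (openConn s y) η) = fun η => c * (g₁ (openEdgeCluster η s) * ind (openConn s y) η) +
        g₂ (openEdgeCluster η s) * ind (openConn s y) η := by
    funext η; ring
  have h2 : (fun η : Set (Sym2 V) => c * g₁ (openEdgeCluster η s) + g₂ (openEdgeCluster η s)) =
      fun η => c * (fun ζ => g₁ (openEdgeCluster ζ s)) η + (fun ζ => g₂ (openEdgeCluster ζ s)) η := by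
    funext η; rfl
  rw [h1, wE_add_smul, h2, wE_add_smul]
  ring

/-- `taC` of a constant test function vanishes. [folklore] -/
theorem taC_const (w : Sym2 V → unitInterval) {q : ℝ} (hq : 0 < q) (s y : V) (X : Set V) (c : ℝ) (ω : Set (Sym2 V)) :
    taC w q s y X (fun _ => c) ω = 0 := by
  simp only [taC]
  rw [wE_const_mul, wE_const w hq]
  ring

/-- `taB` is linear in the test function. [folklore] -/
theorem taB_add_smul (w : Sym2 V → unitInterval) (q : ℝ) (s y : V) (X : Set V) (c : ℝ) (g₁ g₂ : Set (Sym2 V) → ℝ) :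
    taB w q s y X (fun C => c * g₁ C + g₂ C) = c * taB w q s y X g₁ + taB w q s y X g₂ := by
  simp only [taB, taC_add_smul]
  rw [Finset.mul_sum, ← Finset.sum_add_distrib]
  refine Finset.sum_congr rfl fun ω _ => ?_
  ring

/-- `taB` of a constant test function vanishes. [folklore] -/
theorem taB_const (w : Sym2 V → unitInterval) {q : ℝ} (hq : 0 < q) (s y : V) (X : Set V) (c : ℝ) :
    taB w q s y X (fun _ => c) = 0 := by
  simp only [taB, taC_const w hq]
  simp

omit [Fintype V] in
/-- `ind U` is the indicator `1_U`. [folklore] -/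
theorem ind_eq_indicator_one (U : Set (Set (Sym2 V))) :
    (fun C => ind U C) = U.indicator (1 : Set (Sym2 V) → ℝ) := by
  funext C
  by_cases hC : C ∈ U
  · rw [ind_of_mem hC, Set.indicator_of_mem hC]; rfl
  · rw [ind_of_not_mem hC, Set.indicator_of_notMem hC]

/-! ### Lemma `P_v` for every monotone test function (layer cake) -/

/-- **Lemma `P_v` for `φ_{𝐩,q}`, `q ≥ 1`, for EVERY monotone test function `g` of `C_s`** (the hypothesis `hPv` of
`FK.taQ_nonneg_of_Pv` / `FK.deltaN_nonneg_of_Pv` verbatim): both sides are linear in `g` and vanish on constants, and a monotone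
`g` on the finite lattice `Set (Sym2 V)` is `g(∅) + Σ_k m_k 1_{U_k}` with `m_k > 0` and `U_k` increasing (layer cake: peel the
least positive value of `g − g(∅)`), so the indicator case `FK.taB_singleton_le` suffices.
[cite: Gladkov2024, Thm. 3.2 (p. 4)] [cite: VandenbergHaggstromKahn2005, Thm. 1.3 (p. 6)] [cite: Grimmett2006, Thm. (3.8)(b)] -/
theorem taB_singleton_le_of_monotone (u : Sym2 V → unitInterval) {q : ℝ} (hq : 1 ≤ q) {s y : V} (hsy : s ≠ y) (v : V)
    (g : Set (Sym2 V) → ℝ) (hg : Monotone g) :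
    taB u q s y {v} g ≤ rcPartitionFunctionW u q ∅ *
      ((1 - wE u q ∅ (ind ((openConn s y : Set (BondConfig V))ᶜ ∩ openConn y v)) /
            wE u q ∅ (ind (openConn s y : Set (BondConfig V))ᶜ)) *
        (wE u q ∅ (fun η => g (openEdgeCluster η s) * ind (openConn s y) η) -
          wE u q ∅ (fun η => g (openEdgeCluster η s)) * wE u q ∅ (ind (openConn s y)))) := by
  classical
  have hq0 : 0 < q := one_pos.trans_le hq
  set R : (Set (Sym2 V) → ℝ) → ℝ := fun g => rcPartitionFunctionW u q ∅ *
      ((1 - wE u q ∅ (ind ((openConn s y : Set (BondConfig V))ᶜ ∩ openConn y v)) /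
            wE u q ∅ (ind (openConn s y : Set (BondConfig V))ᶜ)) *
        (wE u q ∅ (fun η => g (openEdgeCluster η s) * ind (openConn s y) η) -
          wE u q ∅ (fun η => g (openEdgeCluster η s)) * wE u q ∅ (ind (openConn s y)))) with hR
  show taB u q s y {v} g ≤ R g
  -- both sides are linear and vanish on constants
  have hRlin : ∀ (c : ℝ) (g₁ g₂ : Set (Sym2 V) → ℝ), R (fun C => c * g₁ C + g₂ C) = c * R g₁ + R g₂ := by
    intro c g₁ g₂
    simp only [hR]
    have h1 : (fun η : Set (Sym2 V) => (c * g₁ (openEdgeCluster η s) + g₂ (openEdgeCluster η s)) *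
        ind (openConn s y) η) = fun η => c * (g₁ (openEdgeCluster η s) * ind (openConn s y) η) +
          g₂ (openEdgeCluster η s) * ind (openConn s y) η := by
      funext η; ring
    have h2 : (fun η : Set (Sym2 V) => c * g₁ (openEdgeCluster η s) + g₂ (openEdgeCluster η s)) =
        fun η => c * (fun ζ => g₁ (openEdgeCluster ζ s)) η + (fun ζ => g₂ (openEdgeCluster ζ s)) η := by
      funext η; rfl
    rw [h1, wE_add_smul, h2, wE_add_smul]
    ring
  have hRc : ∀ c : ℝ, R (fun _ => c) = 0 := by
    intro c
    simp only [hR]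
    rw [wE_const_mul, wE_const u hq0]
    ring
  have hBlin : ∀ (c : ℝ) (g₁ g₂ : Set (Sym2 V) → ℝ),
      taB u q s y {v} (fun C => c * g₁ C + g₂ C) = c * taB u q s y {v} g₁ + taB u q s y {v} g₂ :=
    fun c g₁ g₂ => taB_add_smul u q s y {v} c g₁ g₂
  have hBc : ∀ c : ℝ, taB u q s y {v} (fun _ => c) = 0 := fun c => taB_const u hq0 s y {v} c
  have hInd : ∀ U : Set (Set (Sym2 V)), IsUpperSet U → taB u q s y {v} (fun C => ind U C) ≤ R (fun C => ind U C) := by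
    intro U hU
    rw [ind_eq_indicator_one]
    exact taB_singleton_le u hq hsy v U hU
  -- nonnegative monotone test functions, by induction on the size of the support
  have Hpos : ∀ (n : ℕ) (g : Set (Sym2 V) → ℝ), Monotone g → (∀ C, 0 ≤ g C) →
      (Finset.univ.filter (fun C : Set (Sym2 V) => 0 < g C)).card = n → taB u q s y {v} g ≤ R g := by
    intro n
    induction n using Nat.strong_induction_on with
    | _ n ih =>
    intro g hg hg0 hn
    set S : Finset (Set (Sym2 V)) := Finset.univ.filter (fun C : Set (Sym2 V) => 0 < g C) with hS
    by_cases hS0 : S = ∅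
    · -- `g = 0`
      have hg00 : ∀ C, g C = 0 := by
        intro C
        have hC : C ∉ S := by rw [hS0]; exact Finset.notMem_empty C
        have hC' : ¬ 0 < g C := fun h => hC (Finset.mem_filter.2 ⟨Finset.mem_univ C, h⟩)
        exact le_antisymm (not_lt.1 hC') (hg0 C)
      have hgz : g = fun _ => (0 : ℝ) := by funext C; exact hg00 C
      rw [hgz, hBc, hRc]
    · -- peel off `m · 1_U`, `U = {g > 0}`, `m` the least positive value
      have hSne : S.Nonempty := Finset.nonempty_iff_ne_empty.2 hS0
      set m : ℝ := S.inf' hSne g with hm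
      have hmpos : 0 < m := by
        obtain ⟨C, hC, hCm⟩ := Finset.exists_mem_eq_inf' hSne g
        rw [hm, hCm]; exact (Finset.mem_filter.1 hC).2
      have hmle : ∀ C, 0 < g C → m ≤ g C := fun C hC =>
        Finset.inf'_le g (Finset.mem_filter.2 ⟨Finset.mem_univ C, hC⟩)
      set U : Set (Set (Sym2 V)) := {C | 0 < g C} with hU
      have hUup : IsUpperSet U := fun C C' hCC' (hC : 0 < g C) => lt_of_lt_of_le hC (hg hCC')
      set g' : Set (Sym2 V) → ℝ := fun C => g C - m * ind U C with hg'
      have hg'0 : ∀ C, 0 ≤ g' C := by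
        intro C; simp only [hg']
        by_cases hC : 0 < g C
        · rw [ind_of_mem (show C ∈ U from hC)]; linarith [hmle C hC]
        · rw [ind_of_not_mem (show C ∉ U from hC)]; linarith [hg0 C]
      have hg'mono : Monotone g' := by
        intro C C' hCC'
        simp only [hg']
        by_cases hC : 0 < g C
        · have hC' : 0 < g C' := lt_of_lt_of_le hC (hg hCC')
          rw [ind_of_mem (show C ∈ U from hC), ind_of_mem (show C' ∈ U from hC')]
          linarith [hg hCC']
        · rw [ind_of_not_mem (show C ∉ U from hC)]
          have : g C = 0 := le_antisymm (not_lt.1 hC) (hg0 C)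
          rw [this]; linarith [hg'0 C']
      -- the support of `g'` is strictly smaller: the minimisers drop out
      obtain ⟨C₀, hC₀S, hC₀m⟩ := Finset.exists_mem_eq_inf' hSne g
      have hlt : (Finset.univ.filter (fun C : Set (Sym2 V) => 0 < g' C)).card < n := by
        rw [← hn]
        apply Finset.card_lt_card
        refine ⟨fun C hC => ?_, fun hsub => ?_⟩
        · rw [Finset.mem_filter] at hC ⊢
          refine ⟨hC.1, ?_⟩
          by_contra hgC
          have : g' C = 0 := by
            simp only [hg']; rw [ind_of_not_mem (show C ∉ U from hgC)]
            have : g C = 0 := le_antisymm (not_lt.1 hgC) (hg0 C)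
            rw [this]; ring
          linarith [hC.2]
        · have h1 := (Finset.mem_filter.1 (hsub hC₀S)).2
          have h2 : g' C₀ = 0 := by
            simp only [hg']
            rw [ind_of_mem (show C₀ ∈ U from (Finset.mem_filter.1 hC₀S).2), ← hC₀m, hm]; ring
          linarith
      have ih' := ih _ hlt g' hg'mono hg'0 rfl
      have hdec : g = fun C => m * (fun C : Set (Sym2 V) => ind U C) C + g' C := by
        funext C; simp only [hg']; ring
      rw [hdec, hBlin, hRlin]
      exact add_le_add (mul_le_mul_of_nonneg_left (hInd U hUup) hmpos.le) ih'
  -- general monotone `g`: subtract the minimum `g ∅`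
  have hmin : ∀ C, g ∅ ≤ g C := fun C => hg (Set.empty_subset C)
  have hdec : g = fun C => (1 : ℝ) * (fun C => g C - g ∅) C + (fun _ => g ∅) C := by
    funext C; ring
  have key := Hpos _ (fun C => g C - g ∅) (fun C C' h => by dsimp only; linarith [hg h])
    (fun C => by linarith [hmin C]) rfl
  have e1 := hBlin 1 (fun C => g C - g ∅) (fun _ => g ∅)
  have e2 := hRlin 1 (fun C => g C - g ∅) (fun _ => g ∅)
  rw [hBc] at e1
  rw [hRc] at e2
  calc taB u q s y {v} g
      = taB u q s y {v} (fun C => (1 : ℝ) * (fun C => g C - g ∅) C + (fun _ => g ∅) C) := by rw [← hdec]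
    _ = taB u q s y {v} (fun C => g C - g ∅) := by rw [e1]; ring
    _ ≤ R (fun C => g C - g ∅) := key
    _ = R (fun C => (1 : ℝ) * (fun C => g C - g ∅) C + (fun _ => g ∅) C) := by rw [e2]; ring
    _ = R g := by rw [← hdec]

/-! ### `T_A^{FK} ≥ 0` and Lemma `Δ_N^{FK}` for every monotone test function -/

/-- **`T_A ≥ 0` for the random-cluster measure — unconditional, every monotone test function.**  For `φ_{w,q}` with `q ≥ 1`,
every avoided set `X` whose weight-one pairs lie inside `X`, every root `z`, vertices `s ≠ y` and every monotone `g` of the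
open edge cluster of `s`: `Q = A·b − a·B ≥ 0` (prim-hp-7's averaged inequality `T_A ≥ 0`, HP7-MDLX-PROOF (F1), for `φ_{𝐩,q}`).
`FK.taQ_nonneg_of_Pv` with `(P_v)` supplied by `FK.taB_singleton_le_of_monotone`.
[cite: Grimmett2006, Thm. (3.8)(b), (2.17)] [cite: VandenbergHaggstromKahn2005, Thm. 1.3 (p. 6)] [cite: Gladkov2024, Thm. 3.2] -/
theorem taQ_nonneg {q : ℝ} (hq : 1 ≤ q) (s y : V) (hsy : s ≠ y) (g : Set (Sym2 V) → ℝ) (hg : Monotone g)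
    (w : Sym2 V → unitInterval) (X : Set V) (hINV : ∀ p : Sym2 V, ((w p : unitInterval) : ℝ) = 1 → ∀ u ∈ p, u ∈ X)
    (z : V) : 0 ≤ taQ w q s y z X g :=
  taQ_nonneg_of_Pv hq s y hsy g hg (fun u v' => taB_singleton_le_of_monotone u hq hsy v' g hg) w X hINV z

/-- **Lemma `Δ_N` for the random-cluster measure — unconditional, every monotone test function** (the located FK lemma
`(Δ)` of the lane, bschramm/FK-Q2.md §12): for `q ≥ 1`, an avoided set `X` containing every endpoint of a weight-one pair, a
fractional pair `ab` with `a ∈ X`, `s ≠ y` and a monotone `g`,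
`B(w^{ab→0}, X)·b(w^{ab→1}, X ∪ {b}) ≥ B(w^{ab→1}, X ∪ {b})·b(w^{ab→0}, X)`.
`FK.deltaN_nonneg_of_Pv` with `(P_v)` supplied by `FK.taB_singleton_le_of_monotone`.
[cite: Grimmett2006, Thm. (3.8)(b), (2.17)] [cite: VandenbergHaggstromKahn2005, Thm. 1.3 (p. 6)] [cite: Gladkov2024, Thm. 3.2] -/
theorem deltaN_nonneg {q : ℝ} (hq : 1 ≤ q) (s y : V) (hsy : s ≠ y) (g : Set (Sym2 V) → ℝ) (hg : Monotone g)
    (w : Sym2 V → unitInterval) (X : Set V) (hINV : ∀ p : Sym2 V, ((w p : unitInterval) : ℝ) = 1 → ∀ u ∈ p, u ∈ X)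
    {a b : V} (ha : a ∈ X) (hab : a ≠ b) (h0 : 0 < ((w s(a, b) : unitInterval) : ℝ))
    (h1 : ((w s(a, b) : unitInterval) : ℝ) < 1) :
    0 ≤ taB (Function.update w s(a, b) 0) q s y X g * tab (Function.update w s(a, b) 1) q s y (insert b X) -
        taB (Function.update w s(a, b) 1) q s y (insert b X) g * tab (Function.update w s(a, b) 0) q s y X :=
  deltaN_nonneg_of_Pv hq s y hsy g hg (fun u v' => taB_singleton_le_of_monotone u hq hsy v' g hg) w X hINV ha hab h0 h1

end Summit.CriticalPhenomena.PercolationContinuityZ3.Theorems.FK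

end
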